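import Summits.PneNP.PneNP.Theorems.ConvexRankGatesCaptureGRankNormalForm
import Summits.PneNP.PneNP.Theorems.ConvexRankGatesCaptureGRankAndOr
import HarnessLib

/-!
# Crux `Capture` (stmt-PneNP-2659) — GRANK door algebra III: GRANK gates over a common field are closed under
# `∧` and `∨` (any dimensions, any thresholds)

Route PneNP/ConvexRankGates, crux `Summit.PneNP.PneNP.Theses.ConvexRankGates.Capture` (lead c9, 2026-08-17;
`--supports stmt-PneNP-2659`). Assembly of parts I (`ConvexRankGatesCaptureGRankNormalForm.lean`: base change,
full-rank normal form over `Frac F[u,w]`) and II (`ConvexRankGatesCaptureGRankAndOr.lean`: block sum and stacked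
Kronecker products for full-rank gates over one field): two generic-rank threshold gates with data over the SAME
field `F` — dimensions `d₁, d₂`, thresholds `θ₁, θ₂`, arbitrary — computing `f₁, f₂` yield ONE GRANK gate of
dimension `θ₁ + θ₂` computing `f₁ ∧ f₂` and ONE of dimension `2 θ₁ θ₂` computing `f₁ ∨ f₂`
(`isGRankGate_and_or_sameField`; registered stub `grank_sameField_and_or`). The field of the new gates is the
two-step purely transcendental extension `Frac (Frac F[u,w])[u',w']`, into which `F` embeds, so the construction
ITERATES: every `{∧,∨}`-formula whose leaves are GRANK gates over one field is one GRANK gate (dimension additive in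
`∧`, multiplicative in binary `∨`). This is the per-field collapse asserted informally in
`Cruxes/Capture/Ideas/generic-span-hull-shadow-collapse.md` (ideator 3, Props `GRankAndClosed`/`GRankOrClosed`),
now kernel-checked with explicit dimensions; gates over fields of DIFFERENT characteristic are not covered (no
common extension exists). No new definitions. [folklore]
-/

namespace Summit.PneNP.PneNP.Theorems.Capture.GRankAlgebra

set_option linter.dupNamespace false -- `Summit.PneNP.PneNP.…`: summit = sub-problem (D-0017)

open Literature.Computability.Complexity MvPolynomial Matrix

/-- **GRANK gates over a common field are closed under `∧` and `∨`.** Data `(d₁, θ₁, A₀, A)` and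
`(d₂, θ₂, B₀, B)` over the same field `F` computing `f₁, f₂` give `IsGRankGate (θ₁ + θ₂) (f₁ ∧ f₂)` and
`IsGRankGate (2 θ₁ θ₂) (f₁ ∨ f₂)`: normalise gate 1 to full rank over `F₁ = Frac F[u,w]`, move gate 2 to `F₁` and
normalise it over `F₂ = Frac F₁[u',w']`, move the normalised gate 1 to `F₂` (base change never moves the accepted
set), and combine the two full-rank gates over `F₂` by block sum / stacked Kronecker products. [folklore] -/
theorem isGRankGate_and_or_sameField {F : Type} [Field F] {n d₁ θ₁ d₂ θ₂ : ℕ}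
    {f₁ f₂ : (Fin n → Bool) → Bool}
    (A₀ : Matrix (Fin d₁) (Fin d₁) F) (A : Fin n → Matrix (Fin d₁) (Fin d₁) F)
    (B₀ : Matrix (Fin d₂) (Fin d₂) F) (B : Fin n → Matrix (Fin d₂) (Fin d₂) F)
    (h₁ : ∀ v, f₁ v = true ↔ θ₁ ≤ (symbolicMatrix A₀ A v).rank)
    (h₂ : ∀ v, f₂ v = true ↔ θ₂ ≤ (symbolicMatrix B₀ B v).rank) :
    IsGRankGate (θ₁ + θ₂) ⟨n, fun v => f₁ v && f₂ v⟩ ∧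
      IsGRankGate (θ₁ * θ₂ + θ₁ * θ₂) ⟨n, fun v => f₁ v || f₂ v⟩ := by
  -- step 1: gate 1 in full-rank form over `F₁`
  obtain ⟨A₀', A', hA⟩ := fullRank_form θ₁ A₀ A
  set j₁ : F →+* FractionRing (MvPolynomial ((Fin θ₁ × Fin d₁) ⊕ (Fin d₁ × Fin θ₁)) F) := algebraMap _ _
  -- step 2: gate 2 moved to `F₁ = Frac F[u,w]`, then in full-rank form over `F₂ = Frac F₁[u',w']`
  obtain ⟨B₀', B', hB⟩ := fullRank_form θ₂ (B₀.map j₁) (fun i => (B i).map j₁)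
  set j₂ : FractionRing (MvPolynomial ((Fin θ₁ × Fin d₁) ⊕ (Fin d₁ × Fin θ₁)) F) →+*
      FractionRing (MvPolynomial ((Fin θ₂ × Fin d₂) ⊕ (Fin d₂ × Fin θ₂))
        (FractionRing (MvPolynomial ((Fin θ₁ × Fin d₁) ⊕ (Fin d₁ × Fin θ₁)) F))) := algebraMap _ _
  -- step 3: the normalised gate 1 moved to `F₂`; both gates are now full-rank over `F₂`
  have h₁' : ∀ v, f₁ v = true ↔ θ₁ ≤ (symbolicMatrix (A₀'.map j₂) (fun i => (A' i).map j₂) v).rank :=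
    fun v => by rw [le_rank_symbolicMatrix_map_iff, hA, h₁]
  have h₂' : ∀ v, f₂ v = true ↔ θ₂ ≤ (symbolicMatrix B₀' B' v).rank :=
    fun v => by rw [hB, le_rank_symbolicMatrix_map_iff, h₂]
  exact ⟨isGRankGate_and_of_fullRank _ _ _ _ h₁' h₂', isGRankGate_or_of_fullRank _ _ _ _ h₁' h₂'⟩


/-! ## `∨` in FULL-RANK form of dimension `d₁ d₂` -/

/-- **`∨` of two full-rank gates as a FULL-RANK gate of dimension `d₁ d₂`.** Compress part II's stacked-Kronecker gate
(dimension `2 d₁ d₂`, threshold `d₁ d₂`) with part I's generic compression: over `Frac F[u,w]` the disjunction of two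
full-rank GRANK gates over `F` of dimensions `d₁, d₂` is again a FULL-RANK gate, of dimension `d₁ d₂`. Together with the block
sum (`and_fullRank_iff`, dimension `d₁ + d₂`) and base change, full-rank GRANK gates over extensions of one field are closed
under `∧`/`∨` with dimensions `d₁ + d₂` / `d₁ d₂` along any `{∧,∨}`-formula. [folklore] -/
theorem or_fullRank_prod {F : Type} [Field F] {n d₁ d₂ : ℕ}
    (A₀ : Matrix (Fin d₁) (Fin d₁) F) (A : Fin n → Matrix (Fin d₁) (Fin d₁) F)
    (B₀ : Matrix (Fin d₂) (Fin d₂) F) (B : Fin n → Matrix (Fin d₂) (Fin d₂) F) :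
    ∃ (F' : Type) (_ : Field F') (_ : Algebra F F') (K₀' : Matrix (Fin (d₁ * d₂)) (Fin (d₁ * d₂)) F')
      (K' : Fin n → Matrix (Fin (d₁ * d₂)) (Fin (d₁ * d₂)) F'),
      ∀ v : Fin n → Bool, d₁ * d₂ ≤ (symbolicMatrix K₀' K' v).rank ↔
        d₁ ≤ (symbolicMatrix A₀ A v).rank ∨ d₂ ≤ (symbolicMatrix B₀ B v).rank := by
  set e : (Fin d₁ × Fin d₂) ⊕ (Fin d₁ × Fin d₂) ≃ Fin (d₁ * d₂ + d₁ * d₂) :=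
    (Equiv.sumCongr finProdFinEquiv finProdFinEquiv).trans finSumFinEquiv
  set N₀ : Matrix (Fin (d₁ * d₂ + d₁ * d₂)) (Fin (d₁ * d₂ + d₁ * d₂)) F :=
    Matrix.reindex e e (Matrix.fromBlocks (Matrix.kroneckerMap (· * ·) A₀ (1 : Matrix (Fin d₂) (Fin d₂) F)) 0
      (Matrix.kroneckerMap (· * ·) (1 : Matrix (Fin d₁) (Fin d₁) F) B₀) 0)
  set N : Fin n → Matrix (Fin (d₁ * d₂ + d₁ * d₂)) (Fin (d₁ * d₂ + d₁ * d₂)) F := fun t =>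
    Matrix.reindex e e (Matrix.fromBlocks (Matrix.kroneckerMap (· * ·) (A t) (1 : Matrix (Fin d₂) (Fin d₂) F)) 0
      (Matrix.kroneckerMap (· * ·) (1 : Matrix (Fin d₁) (Fin d₁) F) (B t)) 0)
  obtain ⟨K₀', K', h⟩ := fullRank_form (d₁ * d₂) N₀ N
  exact ⟨_, inferInstance, inferInstance, K₀', K', fun v => (h v).trans (or_kronecker_iff A₀ A B₀ B v e)⟩

/-! ## Registered form (stub `grank_sameField_and_or` of crux stmt-PneNP-2659) -/

/-- **Closure of GRANK gates over one field under `∧` and `∨`, closed statement** (the registered stub): any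
dimensions, any thresholds. [folklore] -/
theorem grank_sameField_and_or : ∀ (F : Type) [Field F] (n d₁ θ₁ d₂ θ₂ : ℕ) (f₁ f₂ : (Fin n → Bool) → Bool)
    (A₀ : Matrix (Fin d₁) (Fin d₁) F) (A : Fin n → Matrix (Fin d₁) (Fin d₁) F)
    (B₀ : Matrix (Fin d₂) (Fin d₂) F) (B : Fin n → Matrix (Fin d₂) (Fin d₂) F),
    (∀ v, f₁ v = true ↔ θ₁ ≤ (symbolicMatrix A₀ A v).rank) →
    (∀ v, f₂ v = true ↔ θ₂ ≤ (symbolicMatrix B₀ B v).rank) →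
      IsGRankGate (θ₁ + θ₂) ⟨n, fun v => f₁ v && f₂ v⟩ ∧
        IsGRankGate (θ₁ * θ₂ + θ₁ * θ₂) ⟨n, fun v => f₁ v || f₂ v⟩ :=
  fun _ _ _ _ _ _ _ _ _ A₀ A B₀ B h₁ h₂ => isGRankGate_and_or_sameField A₀ A B₀ B h₁ h₂

/-- **Corollary (size parameters).** With `θᵢ ≤ sᵢ` (as for any accepting-somewhere gate of `GRANK_{sᵢ}`), the
conjunction lies in `GRANK_{s₁+s₂}` and the disjunction in `GRANK_{2 s₁ s₂}`. [folklore] -/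
theorem isGRankGate_and_or_sameField_le {F : Type} [Field F] {n d₁ θ₁ d₂ θ₂ s₁ s₂ : ℕ}
    {f₁ f₂ : (Fin n → Bool) → Bool}
    (A₀ : Matrix (Fin d₁) (Fin d₁) F) (A : Fin n → Matrix (Fin d₁) (Fin d₁) F)
    (B₀ : Matrix (Fin d₂) (Fin d₂) F) (B : Fin n → Matrix (Fin d₂) (Fin d₂) F)
    (h₁ : ∀ v, f₁ v = true ↔ θ₁ ≤ (symbolicMatrix A₀ A v).rank)
    (h₂ : ∀ v, f₂ v = true ↔ θ₂ ≤ (symbolicMatrix B₀ B v).rank) (hs₁ : θ₁ ≤ s₁) (hs₂ : θ₂ ≤ s₂) :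
    IsGRankGate (s₁ + s₂) ⟨n, fun v => f₁ v && f₂ v⟩ ∧
      IsGRankGate (2 * (s₁ * s₂)) ⟨n, fun v => f₁ v || f₂ v⟩ := by
  obtain ⟨hand, hor⟩ := isGRankGate_and_or_sameField A₀ A B₀ B h₁ h₂
  have hmul : θ₁ * θ₂ ≤ s₁ * s₂ := Nat.mul_le_mul hs₁ hs₂
  exact ⟨hand.mono (by omega), hor.mono (by omega)⟩

end Summit.PneNP.PneNP.Theorems.Capture.GRankAlgebra
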